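import Literature.MathematicalPhysics.QuantumFieldTheory.Balaban1983to89.Node00.LargeFieldBackgroundCoPOfRecord
import Literature.MathematicalPhysics.QuantumFieldTheory.Balaban1983to89.Node00.SmallFieldChiOfRecordB

/-!
# NODE 00 — FILE 22′ᴮ: the background of a sequence ON A SUPPORT, of record, OVER PRINT's DETERMINING DATUM [II] (2.3)
# (`bgMSCoPOfRecord(At)B`, `UbgMSCoPOfRecord(At)B` and their spec family)

Cell `pub-ymgap`, seat `pub-ymgap-node00-def-R` (g22), (E1) variant (iii-b) of record (director-ym №338 ∕ №339 (α) ∕ №341 ∕ №342), WORKPLAN-IIIB STAGE 2,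
additive part S2b.  [III] = [Balaban1988Convergent], [15] = [Balaban1985Variational], [6] = [Balaban1985RegularSpaces], [II] = [Balaban1984PropagatorsII].

WHAT.  The print-datum twin of `Node00/LargeFieldBackgroundCoPOfRecord.lean` §3 (:314–:570): the SAME regular class on a support
(`regMSCoPOfRecordAt ν K k Ω₀ Ω` = [15] (2) ∧ (6), UNCHANGED — it is print's own class) and the SAME averaging of record, but the (2.12) constraint read on
PRINT's datum `lamBondsSeq s.Ω k` ([II] (2.3) p. 224, verbatim: *"Λ_j = Ω_j^{(j)} ∖ Ω_{j+1}^{(j)} … (2.3) for the sets of sites and the sets of bonds"* — the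
DIFFERENCE of the bond sets, ruling (α): the inward connectors are NOT constrained) instead of the (b)-datum `genSet s.Ω k` (every bond MEETING `Γ_j`),
through FILE 1ᴮ's `UminOfRecordB`.  HONESTY GUARD (№338 (5)): print-datum twin of `bgMSCoPOfRecord(At) ∕ UbgMSCoPOfRecord(At)` and their spec lemmas
(FLAG №16 ∕ LOCATE-HSEAM 5d3298b8d191f169); the (b)-instance `bgMSCoPOfRecord(At) ∕ UbgMSCoPOfRecord(At)` stays landed and true on its own text (and every
HSEAM-row theorem about it stays a theorem about it); no displayed premise is deleted or weakened here — this file only ADDS the print-datum objects.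

LAYOUT.  §1 the data `bgMSCoPOfRecordAtB ∕ bgMSCoPOfRecordB : DetBackgroundB` and the maps `UbgMSCoPOfRecordAtB ∕ UbgMSCoPOfRecordB` (FILE 22′'s arities,
token for token; only `s.Ω` of the sequence is read) with their unfoldings; §2 the spec family under B-NAMES with the (b) lemmas' argument order —
`isMinimizerB_UbgMSCoPOfRecord(At)B`, `isMinimizerB_setOf_UbgMSCoPOfRecordB`, `solvableDomB_setOf_eq_regMSCoP`, `UbgMSCoPOfRecord(At)B_mem_reg`,
`plaqSmallOn_{topSeq,supp,·}_UbgMSCoPOfRecordB`, `coDiv{SmallOn,SmallOn_supp,SmallOn_bondsOf,ClassOn}_UbgMSCoPOfRecordB`, `agreeOnB_UbgMSCoPOfRecordB`,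
`wilsonAction4_UbgMSCoPOfRecordB_le` (+ `_of_agreeOn`: the (b)-constrained competitors are print-constrained), `UbgMSCoPOfRecord(At)B_{of_not_mem, eq_one_of_not_mem}`,
`UbgMSCoPOfRecord(At)B_congr_of_agreeOnB` (the background reads `𝐖` on `Λ` only), `ubgMSCoPOfRecord(At)B_dichotomy` (minimiser or `1`,
the one face the K0∕N07 row∕lift∕allTorus twins read); §3 the level-`0` clause «U = V₀ on Λ₀» in bond form
(`eq_W0_of_isMinimizerB_zero`, `dist1_W0_lt_of_mem_solvableDomB_regMSCoPAt`).

WHAT THIS FILE IS NOT.  Nothing of Bałaban's is asserted ([15] Thm 1 existence ∕ uniqueness NOT asserted; junk `1` off the solvable set as in FILE 1).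
Purely ADDITIVE; the record `Record13CoP.UbgOfRecord₁₃CoP` is NOT re-pointed by this file (Stage 2's one body edit, filed separately in the gate8
window).  No `instance`, no `notation`, no `sorry`.  HONEST FRAMING: definitions of record; counts unmoved (8∕28 · K 1∕4); K0⁷ stub 1 NOT closed;
finite 𝕋⁴ at fixed ε; NOT continuum ∕ OS ∕ mass-gap ∕ Clay.
-/

noncomputable section

namespace Literature.MathematicalPhysics.QuantumFieldTheory.Balaban1983to89.Node00

open Literature.MathematicalPhysics.QuantumFieldTheory.Balaban1983to89
open T4Continuum B15DeterminingSets B15DeterminingSetsB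

variable (F : T4Family) (N : ℕ) [NeZero N]

/-! ## §1  The (2.12) datum and the background of a sequence in the class on a support, over print's datum -/

/-- **The (2.12) datum on a support, bond-level data**: FILE 1ᴮ's `bgOfRecordB` along the averaging of record in the class `regMSCoPOfRecordAt … Ω₀ Ω`.
Print-datum twin of `bgMSCoPOfRecordAt`. [cite: Balaban1988Convergent, (2.12)–(2.13) p.256–257; Balaban1985Variational, (6) p.278] -/
def bgMSCoPOfRecordAtB (ν : Stage7Numerics) (K k : ℕ) (Ω₀ : Set (Site (F.P K) 0)) (Ω : ℕ → Set (Site (F.P K) 0)) :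
    DetBackgroundB (F.P K) (SU N) (avOfRecord F N K) :=
  bgOfRecordB (avOfRecord F N K) (regMSCoPOfRecordAt F N ν K k Ω₀ Ω)

/-- **The (2.12) datum of record, bond-level data**: the datum on the support of record.  Print-datum twin of `bgMSCoPOfRecord`.
[cite: Balaban1988Convergent, (2.12) p.256, p.255] -/
def bgMSCoPOfRecordB (ν : Stage7Numerics) (K k : ℕ) (Ω : ℕ → Set (Site (F.P K) 0)) : DetBackgroundB (F.P K) (SU N) (avOfRecord F N K) :=
  bgMSCoPOfRecordAtB F N ν K k (suppDomOfRecord F ν K Ω) Ω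

/-- Solution map of the datum on a support = FILE 1ᴮ's `UminOfRecordB` in that class (definitional). [cite: Balaban1988Convergent, (2.12) p.256 (bookkeeping)] -/
theorem bgMSCoPOfRecordAtB_U (ν : Stage7Numerics) (K k : ℕ) (Ω₀ : Set (Site (F.P K) 0)) (Ω : ℕ → Set (Site (F.P K) 0)) :
    (bgMSCoPOfRecordAtB F N ν K k Ω₀ Ω).U = UminOfRecordB (avOfRecord F N K) (regMSCoPOfRecordAt F N ν K k Ω₀ Ω) := rfl

/-- Domain of the datum on a support = FILE 1ᴮ's solvable set in that class (definitional). [cite: Balaban1988Convergent, (2.12) p.256 (bookkeeping)] -/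
theorem bgMSCoPOfRecordAtB_dom (ν : Stage7Numerics) (K k : ℕ) (Ω₀ : Set (Site (F.P K) 0)) (Ω : ℕ → Set (Site (F.P K) 0)) :
    (bgMSCoPOfRecordAtB F N ν K k Ω₀ Ω).dom = solvableDomB (avOfRecord F N K) (regMSCoPOfRecordAt F N ν K k Ω₀ Ω) := rfl

/-- Class of the datum on a support (definitional; print's class, unchanged). [cite: Balaban1985Variational, (6) p.278 (bookkeeping)] -/
theorem bgMSCoPOfRecordAtB_reg (ν : Stage7Numerics) (K k : ℕ) (Ω₀ : Set (Site (F.P K) 0)) (Ω : ℕ → Set (Site (F.P K) 0)) :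
    (bgMSCoPOfRecordAtB F N ν K k Ω₀ Ω).reg = regMSCoPOfRecordAt F N ν K k Ω₀ Ω := rfl

/-- The datum of record is the datum on the support of record (definitional). [cite: Balaban1988Convergent, p.255 (bookkeeping)] -/
theorem bgMSCoPOfRecordB_eq_At (ν : Stage7Numerics) (K k : ℕ) (Ω : ℕ → Set (Site (F.P K) 0)) :
    bgMSCoPOfRecordB F N ν K k Ω = bgMSCoPOfRecordAtB F N ν K k (suppDomOfRecord F ν K Ω) Ω := rfl

/-- The (b) datum on a support is the pull-back of the bond-level one (definitional). [cite: Balaban1988Convergent, (2.12)–(2.13) p.256–257 (bookkeeping)] -/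
theorem bgMSCoPOfRecordAtB_toDetBackground (ν : Stage7Numerics) (K k : ℕ) (Ω₀ : Set (Site (F.P K) 0)) (Ω : ℕ → Set (Site (F.P K) 0)) :
    (bgMSCoPOfRecordAtB F N ν K k Ω₀ Ω).toDetBackground = bgMSCoPOfRecordAt F N ν K k Ω₀ Ω := rfl

/-- **THE BACKGROUND OF A SEQUENCE ON A SUPPORT, PRINT's DATUM** — `U_k(s)(𝐖)`: a minimal configuration of [15] (5) on (6) with the class posed on the
support `Ω₀` and the averaging constraints `M(U) = 𝐖` on the bonds of `Λ_j` ([II] (2.3)): FILE 1ᴮ's `UminOfRecordB` at `(avOfRecord, regMSCoPOfRecordAt … Ω₀ s.Ω,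
lamBondsSeq s.Ω k)`.  TOTAL (junk `1` off the solvable set); [15] Thm 1 NOT asserted.  Print-datum twin of `UbgMSCoPOfRecordAt` (FLAG №16 ∕ LOCATE-HSEAM
5d3298b8d191f169); the (b)-instance `UbgMSCoPOfRecordAt` stays landed and true on its own text.
[cite: Balaban1985Variational, (5)–(6) p.278, Thm 1 (8) p.279; Balaban1988Convergent, (2.12)–(2.13) p.256–257, p.255; Balaban1984PropagatorsII, (2.3) p.224] -/
def UbgMSCoPOfRecordAtB (ν : Stage7Numerics) (M : ℕ) (g : ℕ → ℝ) (K k : ℕ) (Ω₀ : Set (Site (F.P K) 0)) (s : SeqOfRecord F ν M g K k) :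
    MSField (F.P K) (SU N) → GaugeField (F.P K) 0 (SU N) :=
  UminOfRecordB (avOfRecord F N K) (regMSCoPOfRecordAt F N ν K k Ω₀ s.Ω) (lamBondsSeq s.Ω k)

/-- **THE BACKGROUND FIELD OF A SEQUENCE, OF RECORD — SUPPORT EDITION, PRINT's DATUM** (FILE 22′'s arity): the background on the support of record
`Ω₀(s) = suppDomOfRecord ν K s.Ω`.  TOTAL; [15] Thm 1 NOT asserted.  Print-datum twin of `UbgMSCoPOfRecord` (FLAG №16 ∕ LOCATE-HSEAM 5d3298b8d191f169); the
(b)-instance `UbgMSCoPOfRecord` stays landed and true on its own text.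
[cite: Balaban1985Variational, (5)–(6) p.278, Thm 1 (8) p.279; Balaban1988Convergent, (2.12)–(2.13) p.256–257, p.255; Balaban1984PropagatorsII, (2.3) p.224] -/
def UbgMSCoPOfRecordB (ν : Stage7Numerics) (M : ℕ) (g : ℕ → ℝ) (K k : ℕ) (s : SeqOfRecord F ν M g K k) :
    MSField (F.P K) (SU N) → GaugeField (F.P K) 0 (SU N) :=
  UbgMSCoPOfRecordAtB F N ν M g K k (suppDomOfRecord F ν K s.Ω) s

variable {F N}

/-- Unfolding to FILE 1ᴮ's solution map on `lamBondsSeq s.Ω k` in the class on a support (definitional). [cite: Balaban1988Convergent, (2.13) p.257] -/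
theorem UbgMSCoPOfRecordAtB_apply (ν : Stage7Numerics) (M : ℕ) (g : ℕ → ℝ) (K k : ℕ) (Ω₀ : Set (Site (F.P K) 0)) (s : SeqOfRecord F ν M g K k)
    (W : MSField (F.P K) (SU N)) :
    UbgMSCoPOfRecordAtB F N ν M g K k Ω₀ s W = UminOfRecordB (avOfRecord F N K) (regMSCoPOfRecordAt F N ν K k Ω₀ s.Ω) (lamBondsSeq s.Ω k) W := rfl

/-- It is the solution map of the bond-level datum on a support at print's datum (definitional). [cite: Balaban1988Convergent, (2.13) p.257 (bookkeeping)] -/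
theorem UbgMSCoPOfRecordAtB_eq_bgU (ν : Stage7Numerics) (M : ℕ) (g : ℕ → ℝ) (K k : ℕ) (Ω₀ : Set (Site (F.P K) 0)) (s : SeqOfRecord F ν M g K k) :
    UbgMSCoPOfRecordAtB F N ν M g K k Ω₀ s = (bgMSCoPOfRecordAtB F N ν K k Ω₀ s.Ω).U (lamBondsSeq s.Ω k) := rfl

/-- The background of record is the background on the support of record (definitional). [cite: Balaban1988Convergent, p.255 (bookkeeping)] -/
theorem UbgMSCoPOfRecordB_eq_At (ν : Stage7Numerics) (M : ℕ) (g : ℕ → ℝ) (K k : ℕ) (s : SeqOfRecord F ν M g K k) :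
    UbgMSCoPOfRecordB F N ν M g K k s = UbgMSCoPOfRecordAtB F N ν M g K k (suppDomOfRecord F ν K s.Ω) s := rfl

/-- Unfolding to FILE 1ᴮ's solution map on `Λ({Ω_j(s)}) = lamBondsSeq s.Ω k` in the class of record (definitional). [cite: Balaban1988Convergent, (2.13) p.257] -/
theorem UbgMSCoPOfRecordB_apply (ν : Stage7Numerics) (M : ℕ) (g : ℕ → ℝ) (K k : ℕ) (s : SeqOfRecord F ν M g K k) (W : MSField (F.P K) (SU N)) :
    UbgMSCoPOfRecordB F N ν M g K k s W = UminOfRecordB (avOfRecord F N K) (regMSCoPOfRecord F N ν K k s.Ω) (lamBondsSeq s.Ω k) W := rfl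

/-- The background reads only the domain sequence of `s`: two sequences of record with the same `Ω` have the same background (definitional congruence).
[cite: Balaban1988Convergent, (2.13) p.257 (bookkeeping)] -/
theorem UbgMSCoPOfRecordAtB_congr_Omega (ν : Stage7Numerics) {M M' : ℕ} {g g' : ℕ → ℝ} (K k : ℕ) (Ω₀ : Set (Site (F.P K) 0))
    (s : SeqOfRecord F ν M g K k) (s' : SeqOfRecord F ν M' g' K k) (h : s.Ω = s'.Ω) :
    UbgMSCoPOfRecordAtB F N ν M g K k Ω₀ s = UbgMSCoPOfRecordAtB F N ν M' g' K k Ω₀ s' := by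
  unfold UbgMSCoPOfRecordAtB
  rw [h]

/-! ## §2  The spec family (B-names; the (b) lemmas' argument order) -/

/-- **THE CHARACTERISING PROPERTY on the solvable set, on a support**: `U_k(s)(𝐖)` IS a minimal configuration of (5) on (6) under the constraints on `Λ`.
[cite: Balaban1985Variational, (5)–(6) p.278; Balaban1988Convergent, (2.12) p.256; Balaban1984PropagatorsII, (2.3) p.224] -/
theorem isMinimizerB_UbgMSCoPOfRecordAtB (ν : Stage7Numerics) (M : ℕ) (g : ℕ → ℝ) (K k : ℕ) (Ω₀ : Set (Site (F.P K) 0)) (s : SeqOfRecord F ν M g K k)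
    {W : MSField (F.P K) (SU N)} (hW : W ∈ solvableDomB (avOfRecord F N K) (regMSCoPOfRecordAt F N ν K k Ω₀ s.Ω) (lamBondsSeq s.Ω k)) :
    IsMinimizerB (avOfRecord F N K) (regMSCoPOfRecordAt F N ν K k Ω₀ s.Ω) (lamBondsSeq s.Ω k) W (UbgMSCoPOfRecordAtB F N ν M g K k Ω₀ s W) :=
  isMinimizerB_UminOfRecordB (avOfRecord F N K) (regMSCoPOfRecordAt F N ν K k Ω₀ s.Ω) hW

/-- **THE CHARACTERISING PROPERTY on the solvable set, of record**: `U_k(s)(𝐖)` IS a minimal configuration of (5) on (6) for `Λ({Ω_j(s)})` and `𝐖`.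
[cite: Balaban1985Variational, (5)–(6) p.278; Balaban1988Convergent, (2.12) p.256; Balaban1984PropagatorsII, (2.3) p.224] -/
theorem isMinimizerB_UbgMSCoPOfRecordB (ν : Stage7Numerics) (M : ℕ) (g : ℕ → ℝ) (K k : ℕ) (s : SeqOfRecord F ν M g K k)
    {W : MSField (F.P K) (SU N)} (hW : W ∈ solvableDomB (avOfRecord F N K) (regMSCoPOfRecord F N ν K k s.Ω) (lamBondsSeq s.Ω k)) :
    IsMinimizerB (avOfRecord F N K) (regMSCoPOfRecord F N ν K k s.Ω) (lamBondsSeq s.Ω k) W (UbgMSCoPOfRecordB F N ν M g K k s W) :=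
  isMinimizerB_UminOfRecordB (avOfRecord F N K) (regMSCoPOfRecord F N ν K k s.Ω) hW

/-- The same characterising property with the class DISPLAYED as the explicit set of [15] (2) ∧ (6) (definitional unfolding of `regMSCoPOfRecord`).
[cite: Balaban1985Variational, (2),(6) p.278 (bookkeeping)] -/
theorem isMinimizerB_setOf_UbgMSCoPOfRecordB (ν : Stage7Numerics) (M : ℕ) (g : ℕ → ℝ) (K k : ℕ) (s : SeqOfRecord F ν M g K k)
    {W : MSField (F.P K) (SU N)} (hW : W ∈ solvableDomB (avOfRecord F N K) (regMSCoPOfRecord F N ν K k s.Ω) (lamBondsSeq s.Ω k)) :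
    IsMinimizerB (avOfRecord F N K)
      {U | (∀ j, j ≤ k → PlaqSmallOn (B8Eq17ClassAkV1.plaqsOf (topSeq (suppDomOfRecord F ν K s.Ω) s.Ω j)) (ν.εreg * (F.P K).eta j ^ 2) U) ∧
        (∀ j, j ≤ k → Sect2.CoDivSmallOn (bondsOf (topSeq (suppDomOfRecord F ν K s.Ω) s.Ω j)) (ν.εreg * (F.P K).eta j ^ 3) U)}
      (lamBondsSeq s.Ω k) W (UbgMSCoPOfRecordB F N ν M g K k s W) :=
  isMinimizerB_UbgMSCoPOfRecordB ν M g K k s hW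

/-- The solvable set with the class displayed explicitly is the solvable set of record (definitional). [cite: Balaban1985Variational, (6),(8) p.278–279 (bookkeeping)] -/
theorem solvableDomB_setOf_eq_regMSCoP (ν : Stage7Numerics) (K k : ℕ) (Ω : ℕ → Set (Site (F.P K) 0)) :
    solvableDomB (avOfRecord F N K)
      {U | (∀ j, j ≤ k → PlaqSmallOn (B8Eq17ClassAkV1.plaqsOf (topSeq (suppDomOfRecord F ν K Ω) Ω j)) (ν.εreg * (F.P K).eta j ^ 2) U) ∧
        (∀ j, j ≤ k → Sect2.CoDivSmallOn (bondsOf (topSeq (suppDomOfRecord F ν K Ω) Ω j)) (ν.εreg * (F.P K).eta j ^ 3) U)} (lamBondsSeq Ω k) =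
      solvableDomB (avOfRecord F N K) (regMSCoPOfRecord F N ν K k Ω) (lamBondsSeq Ω k) := rfl

/-- On the solvable set `U_k(s)(𝐖)` lies in the class on the support. [cite: Balaban1985Variational, (2),(6) p.278] -/
theorem UbgMSCoPOfRecordAtB_mem_reg (ν : Stage7Numerics) (M : ℕ) (g : ℕ → ℝ) (K k : ℕ) (Ω₀ : Set (Site (F.P K) 0)) (s : SeqOfRecord F ν M g K k)
    {W : MSField (F.P K) (SU N)} (hW : W ∈ solvableDomB (avOfRecord F N K) (regMSCoPOfRecordAt F N ν K k Ω₀ s.Ω) (lamBondsSeq s.Ω k)) :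
    UbgMSCoPOfRecordAtB F N ν M g K k Ω₀ s W ∈ regMSCoPOfRecordAt F N ν K k Ω₀ s.Ω :=
  (isMinimizerB_UbgMSCoPOfRecordAtB ν M g K k Ω₀ s hW).mem_reg

/-- On the solvable set `U_k(s)(𝐖)` lies in the class of record. [cite: Balaban1985Variational, (2),(6) p.278] -/
theorem UbgMSCoPOfRecordB_mem_reg (ν : Stage7Numerics) (M : ℕ) (g : ℕ → ℝ) (K k : ℕ) (s : SeqOfRecord F ν M g K k)
    {W : MSField (F.P K) (SU N)} (hW : W ∈ solvableDomB (avOfRecord F N K) (regMSCoPOfRecord F N ν K k s.Ω) (lamBondsSeq s.Ω k)) :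
    UbgMSCoPOfRecordB F N ν M g K k s W ∈ regMSCoPOfRecord F N ν K k s.Ω :=
  (isMinimizerB_UbgMSCoPOfRecordB ν M g K k s hW).mem_reg

/-- On the solvable set: (1.7) at the minimiser at every scale `j ≤ k`, on the plaquettes of `Ω_j(s)` (`Ω₀(s)` the support of record).
[cite: Balaban1985RegularSpaces, (1.7) p.77; Balaban1985Variational, (2),(6) p.278] -/
theorem plaqSmallOn_topSeq_UbgMSCoPOfRecordB (ν : Stage7Numerics) (M : ℕ) (g : ℕ → ℝ) (K k : ℕ) (s : SeqOfRecord F ν M g K k)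
    {W : MSField (F.P K) (SU N)} (hW : W ∈ solvableDomB (avOfRecord F N K) (regMSCoPOfRecord F N ν K k s.Ω) (lamBondsSeq s.Ω k))
    {j : ℕ} (hjk : j ≤ k) :
    PlaqSmallOn (B8Eq17ClassAkV1.plaqsOf (topSeq (suppDomOfRecord F ν K s.Ω) s.Ω j)) (ν.εreg * (F.P K).eta j ^ 2)
      (UbgMSCoPOfRecordB F N ν M g K k s W) :=
  (UbgMSCoPOfRecordB_mem_reg ν M g K k s hW).1 j hjk

/-- On the solvable set: (1.7) at the minimiser, scale `0` — on the plaquettes of the SUPPORT of record. [cite: Balaban1985Variational, (2) p.278 (j = 0); Balaban1988Convergent, p.255] -/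
theorem plaqSmallOn_supp_UbgMSCoPOfRecordB (ν : Stage7Numerics) (M : ℕ) (g : ℕ → ℝ) (K k : ℕ) (s : SeqOfRecord F ν M g K k)
    {W : MSField (F.P K) (SU N)} (hW : W ∈ solvableDomB (avOfRecord F N K) (regMSCoPOfRecord F N ν K k s.Ω) (lamBondsSeq s.Ω k)) :
    PlaqSmallOn (B8Eq17ClassAkV1.plaqsOf (suppDomOfRecord F ν K s.Ω)) (ν.εreg * (F.P K).eta 0 ^ 2) (UbgMSCoPOfRecordB F N ν M g K k s W) :=
  (UbgMSCoPOfRecordB_mem_reg ν M g K k s hW).1 0 (Nat.zero_le k)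

/-- On the solvable set: (1.7) at the minimiser, scale `1 ≤ j ≤ k` — the plaquettes meeting `Ω_j(s)` (FILE 22′'s face, token for token).
[cite: Balaban1985RegularSpaces, (1.7) p.77; Balaban1985Variational, (6),(8) p.278–279] -/
theorem plaqSmallOn_UbgMSCoPOfRecordB (ν : Stage7Numerics) (M : ℕ) (g : ℕ → ℝ) (K k : ℕ) (s : SeqOfRecord F ν M g K k)
    {W : MSField (F.P K) (SU N)} (hW : W ∈ solvableDomB (avOfRecord F N K) (regMSCoPOfRecord F N ν K k s.Ω) (lamBondsSeq s.Ω k))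
    {j : ℕ} (hj : 1 ≤ j) (hjk : j ≤ k) :
    PlaqSmallOn (B8Eq17ClassAkV1.plaqsOf (s.Ω j)) (ν.εreg * (F.P K).eta j ^ 2) (UbgMSCoPOfRecordB F N ν M g K k s W) :=
  plaqSmallOn_of_mem_regMSCoPOfRecord (UbgMSCoPOfRecordB_mem_reg ν M g K k s hW) hj hjk

/-- On the solvable set: (1.9) at the minimiser at every scale `j ≤ k`, on the bonds of `Ω_j(s)` (`Ω₀(s)` the support of record) — (1.9) AT THE MINIMISER BY
MEMBERSHIP (director-ym №149 (5)). [cite: Balaban1985RegularSpaces, (1.9) p.77; Balaban1985Variational, (2),(6) p.278] -/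
theorem coDivSmallOn_UbgMSCoPOfRecordB (ν : Stage7Numerics) (M : ℕ) (g : ℕ → ℝ) (K k : ℕ) (s : SeqOfRecord F ν M g K k)
    {W : MSField (F.P K) (SU N)} (hW : W ∈ solvableDomB (avOfRecord F N K) (regMSCoPOfRecord F N ν K k s.Ω) (lamBondsSeq s.Ω k))
    {j : ℕ} (hjk : j ≤ k) :
    Sect2.CoDivSmallOn (bondsOf (topSeq (suppDomOfRecord F ν K s.Ω) s.Ω j)) (ν.εreg * (F.P K).eta j ^ 3) (UbgMSCoPOfRecordB F N ν M g K k s W) :=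
  (UbgMSCoPOfRecordB_mem_reg ν M g K k s hW).2 j hjk

/-- On the solvable set: (1.9) at the minimiser, scale `0` — on the bonds of the SUPPORT of record. [cite: Balaban1985Variational, (2) p.278 (j = 0); Balaban1988Convergent, p.255] -/
theorem coDivSmallOn_supp_UbgMSCoPOfRecordB (ν : Stage7Numerics) (M : ℕ) (g : ℕ → ℝ) (K k : ℕ) (s : SeqOfRecord F ν M g K k)
    {W : MSField (F.P K) (SU N)} (hW : W ∈ solvableDomB (avOfRecord F N K) (regMSCoPOfRecord F N ν K k s.Ω) (lamBondsSeq s.Ω k)) :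
    Sect2.CoDivSmallOn (bondsOf (suppDomOfRecord F ν K s.Ω)) (ν.εreg * (F.P K).eta 0 ^ 3) (UbgMSCoPOfRecordB F N ν M g K k s W) :=
  (UbgMSCoPOfRecordB_mem_reg ν M g K k s hW).2 0 (Nat.zero_le k)

/-- On the solvable set: (1.9) at the minimiser on `bondsOf (s.Ω j)`, `1 ≤ j ≤ k` (FILE 22′'s face, token for token). [cite: Balaban1985RegularSpaces, (1.9) p.77] -/
theorem coDivSmallOn_bondsOf_UbgMSCoPOfRecordB (ν : Stage7Numerics) (M : ℕ) (g : ℕ → ℝ) (K k : ℕ) (s : SeqOfRecord F ν M g K k)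
    {W : MSField (F.P K) (SU N)} (hW : W ∈ solvableDomB (avOfRecord F N K) (regMSCoPOfRecord F N ν K k s.Ω) (lamBondsSeq s.Ω k))
    {j : ℕ} (hj : 1 ≤ j) (hjk : j ≤ k) :
    Sect2.CoDivSmallOn (bondsOf (s.Ω j)) (ν.εreg * (F.P K).eta j ^ 3) (UbgMSCoPOfRecordB F N ν M g K k s W) :=
  coDivSmallOn_bondsOf_of_mem_regMSCoPOfRecord (UbgMSCoPOfRecordB_mem_reg ν M g K k s hW) hj hjk

/-- On the solvable set: THE WHOLE (1.9) FAMILY at the minimiser, `j = 0, …, k` (support edition, print's datum).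
[cite: Balaban1985RegularSpaces, (1.9) p.77; Balaban1985Variational, (2),(6) p.278; Balaban1988Convergent, p.255] -/
theorem coDivClassOn_UbgMSCoPOfRecordB (ν : Stage7Numerics) (M : ℕ) (g : ℕ → ℝ) (K k : ℕ) (s : SeqOfRecord F ν M g K k)
    {W : MSField (F.P K) (SU N)} (hW : W ∈ solvableDomB (avOfRecord F N K) (regMSCoPOfRecord F N ν K k s.Ω) (lamBondsSeq s.Ω k)) :
    ∀ j, j ≤ k →
      Sect2.CoDivSmallOn (bondsOf (topSeq (suppDomOfRecord F ν K s.Ω) s.Ω j)) (ν.εreg * (F.P K).eta j ^ 3) (UbgMSCoPOfRecordB F N ν M g K k s W) :=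
  (UbgMSCoPOfRecordB_mem_reg ν M g K k s hW).2

/-- On the solvable set the averages of `U_k(s)(𝐖)` agree with `𝐖` on print's datum: `M(U_k(s)(𝐖)) = 𝐖` on the bonds of every `Λ_j` — in particular
«U = V₀ on Λ₀» ((1.12), the scale-`0` constraint, read on the DIFFERENCE of the bond sets). [cite: Balaban1985Variational, (3) p.278; Balaban1988Convergent, (2.11)–(2.12) p.256, (1.12) p.248; Balaban1984PropagatorsII, (2.3) p.224] -/
theorem agreeOnB_UbgMSCoPOfRecordB (ν : Stage7Numerics) (M : ℕ) (g : ℕ → ℝ) (K k : ℕ) (s : SeqOfRecord F ν M g K k)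
    {W : MSField (F.P K) (SU N)} (hW : W ∈ solvableDomB (avOfRecord F N K) (regMSCoPOfRecord F N ν K k s.Ω) (lamBondsSeq s.Ω k)) :
    AgreeOnB (lamBondsSeq s.Ω k) (avgFamily (avOfRecord F N K) (UbgMSCoPOfRecordB F N ν M g K k s W)) W :=
  (isMinimizerB_UbgMSCoPOfRecordB ν M g K k s hW).agreeOnB

/-- On the solvable set `U_k(s)(𝐖)` minimises the Wilson action among the class-of-record configurations with the same averages on `Λ`.
[cite: Balaban1985Variational, (5)–(6) p.278] -/
theorem wilsonAction4_UbgMSCoPOfRecordB_le (ν : Stage7Numerics) (M : ℕ) (g : ℕ → ℝ) (K k : ℕ) (s : SeqOfRecord F ν M g K k)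
    {W : MSField (F.P K) (SU N)} (hW : W ∈ solvableDomB (avOfRecord F N K) (regMSCoPOfRecord F N ν K k s.Ω) (lamBondsSeq s.Ω k))
    {U : GaugeField (F.P K) 0 (SU N)} (hU : U ∈ regMSCoPOfRecord F N ν K k s.Ω)
    (hUW : AgreeOnB (lamBondsSeq s.Ω k) (avgFamily (avOfRecord F N K) U) W) :
    wilsonAction4 (UbgMSCoPOfRecordB F N ν M g K k s W) ≤ wilsonAction4 U :=
  (isMinimizerB_UbgMSCoPOfRecordB ν M g K k s hW).le hU hUW

/-- … in particular among the class-of-record configurations satisfying the (b)-constraint on `genSet s.Ω k` (which constrains MORE bonds: F0a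
`agreeOnB_lamBondsSeq_avgFamily_of_agreeOn`). [cite: Balaban1985Variational, (5)–(6) p.278; Balaban1988Convergent, (2.10) p.256] -/
theorem wilsonAction4_UbgMSCoPOfRecordB_le_of_agreeOn (ν : Stage7Numerics) (M : ℕ) (g : ℕ → ℝ) (K k : ℕ) (s : SeqOfRecord F ν M g K k)
    {W : MSField (F.P K) (SU N)} (hW : W ∈ solvableDomB (avOfRecord F N K) (regMSCoPOfRecord F N ν K k s.Ω) (lamBondsSeq s.Ω k))
    {U : GaugeField (F.P K) 0 (SU N)} (hU : U ∈ regMSCoPOfRecord F N ν K k s.Ω)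
    (hUW : AgreeOn (genSet s.Ω k) (avgFamily (avOfRecord F N K) U) W) :
    wilsonAction4 (UbgMSCoPOfRecordB F N ν M g K k s W) ≤ wilsonAction4 U :=
  wilsonAction4_UbgMSCoPOfRecordB_le ν M g K k s hW hU (agreeOnB_lamBondsSeq_avgFamily_of_agreeOn hUW)

/-- Off the solvable set the background on a support is the unit configuration (documented junk default of FILE 1ᴮ).
[cite: Balaban1988Convergent, (2.12) p.256 (typing convention)] -/
theorem UbgMSCoPOfRecordAtB_of_not_mem (ν : Stage7Numerics) (M : ℕ) (g : ℕ → ℝ) (K k : ℕ) (Ω₀ : Set (Site (F.P K) 0)) (s : SeqOfRecord F ν M g K k)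
    {W : MSField (F.P K) (SU N)} (hW : W ∉ solvableDomB (avOfRecord F N K) (regMSCoPOfRecordAt F N ν K k Ω₀ s.Ω) (lamBondsSeq s.Ω k)) :
    UbgMSCoPOfRecordAtB F N ν M g K k Ω₀ s W = fun _ => 1 :=
  UminOfRecordB_of_not (avOfRecord F N K) (regMSCoPOfRecordAt F N ν K k Ω₀ s.Ω) (by rwa [mem_solvableDomB_iff] at hW)

/-- Off the solvable set `U_k(s)(𝐖)` is the unit configuration (documented junk default of FILE 1ᴮ). [cite: Balaban1988Convergent, (2.12) p.256 (typing convention)] -/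
theorem UbgMSCoPOfRecordB_of_not_mem (ν : Stage7Numerics) (M : ℕ) (g : ℕ → ℝ) (K k : ℕ) (s : SeqOfRecord F ν M g K k)
    {W : MSField (F.P K) (SU N)} (hW : W ∉ solvableDomB (avOfRecord F N K) (regMSCoPOfRecord F N ν K k s.Ω) (lamBondsSeq s.Ω k)) :
    UbgMSCoPOfRecordB F N ν M g K k s W = fun _ => 1 :=
  UminOfRecordB_of_not (avOfRecord F N K) (regMSCoPOfRecord F N ν K k s.Ω) (by rwa [mem_solvableDomB_iff] at hW)

/-- The same junk face with the unit written as `1`. [cite: Balaban1988Convergent, (2.12) p.256 (typing convention)] -/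
theorem UbgMSCoPOfRecordAtB_eq_one_of_not_mem (ν : Stage7Numerics) (M : ℕ) (g : ℕ → ℝ) (K k : ℕ) (Ω₀ : Set (Site (F.P K) 0))
    (s : SeqOfRecord F ν M g K k) {W : MSField (F.P K) (SU N)}
    (hW : W ∉ solvableDomB (avOfRecord F N K) (regMSCoPOfRecordAt F N ν K k Ω₀ s.Ω) (lamBondsSeq s.Ω k)) :
    UbgMSCoPOfRecordAtB F N ν M g K k Ω₀ s W = 1 :=
  UbgMSCoPOfRecordAtB_of_not_mem ν M g K k Ω₀ s hW

/-- The same junk face with the unit written as `1`. [cite: Balaban1988Convergent, (2.12) p.256 (typing convention)] -/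
theorem UbgMSCoPOfRecordB_eq_one_of_not_mem (ν : Stage7Numerics) (M : ℕ) (g : ℕ → ℝ) (K k : ℕ) (s : SeqOfRecord F ν M g K k)
    {W : MSField (F.P K) (SU N)} (hW : W ∉ solvableDomB (avOfRecord F N K) (regMSCoPOfRecord F N ν K k s.Ω) (lamBondsSeq s.Ω k)) :
    UbgMSCoPOfRecordB F N ν M g K k s W = 1 :=
  UbgMSCoPOfRecordB_of_not_mem ν M g K k s hW

/-- **THE BACKGROUND READS `𝐖` ON `Λ` ONLY** (both branches): data agreeing on the bonds of print's datum have the same background on a support.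
[cite: Balaban1988Convergent, (2.12)–(2.13) p.256–257 (bookkeeping); Balaban1984PropagatorsII, (2.3) p.224] -/
theorem UbgMSCoPOfRecordAtB_congr_of_agreeOnB (ν : Stage7Numerics) (M : ℕ) (g : ℕ → ℝ) (K k : ℕ) (Ω₀ : Set (Site (F.P K) 0)) (s : SeqOfRecord F ν M g K k)
    {W W' : MSField (F.P K) (SU N)} (h : AgreeOnB (lamBondsSeq s.Ω k) W W') :
    UbgMSCoPOfRecordAtB F N ν M g K k Ω₀ s W = UbgMSCoPOfRecordAtB F N ν M g K k Ω₀ s W' :=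
  UminOfRecordB_congr_of_agreeOnB (avOfRecord F N K) (regMSCoPOfRecordAt F N ν K k Ω₀ s.Ω) h

/-- The same for the background of record. [cite: Balaban1988Convergent, (2.12)–(2.13) p.256–257 (bookkeeping); Balaban1984PropagatorsII, (2.3) p.224] -/
theorem UbgMSCoPOfRecordB_congr_of_agreeOnB (ν : Stage7Numerics) (M : ℕ) (g : ℕ → ℝ) (K k : ℕ) (s : SeqOfRecord F ν M g K k)
    {W W' : MSField (F.P K) (SU N)} (h : AgreeOnB (lamBondsSeq s.Ω k) W W') :
    UbgMSCoPOfRecordB F N ν M g K k s W = UbgMSCoPOfRecordB F N ν M g K k s W' :=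
  UbgMSCoPOfRecordAtB_congr_of_agreeOnB ν M g K k _ s h

/-- … in particular data agreeing on the (b)-datum `genSet s.Ω k` (more bonds) have the same print-datum background. [cite: Balaban1988Convergent, (2.10) p.256 (bookkeeping)] -/
theorem UbgMSCoPOfRecordB_congr_of_agreeOn (ν : Stage7Numerics) (M : ℕ) (g : ℕ → ℝ) (K k : ℕ) (s : SeqOfRecord F ν M g K k)
    {W W' : MSField (F.P K) (SU N)} (h : AgreeOn (genSet s.Ω k) W W') :
    UbgMSCoPOfRecordB F N ν M g K k s W = UbgMSCoPOfRecordB F N ν M g K k s W' :=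
  UbgMSCoPOfRecordB_congr_of_agreeOnB ν M g K k s (AgreeOnB.lamBondsSeq_of_genSet h)

/-- **THE DICHOTOMY OF THE TOTAL BACKGROUND, class-`At` form**: either the datum is solvable and `Ubg` IS print's minimiser, or `Ubg = 1` (the junk face).
Asked for by the K0∕N07 row∕lift∕allTorus twins (k0-s1-w1), shape of `ubgMSCoPOfRecord_dichotomy_genSetDatum` with print's datum `lamBondsSeq`.
[cite: Balaban1988Convergent, (2.12)–(2.13) p.256–257; Balaban1984PropagatorsII, (2.3) p.224 (bookkeeping: the two branches of a TOTAL definition)] -/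
theorem ubgMSCoPOfRecordAtB_dichotomy (ν : Stage7Numerics) (M : ℕ) (g : ℕ → ℝ) (K k : ℕ) (Ω₀ : Set (Site (F.P K) 0))
    (s : SeqOfRecord F ν M g K k) (W : MSField (F.P K) (SU N)) :
    IsMinimizerB (avOfRecord F N K) (regMSCoPOfRecordAt F N ν K k Ω₀ s.Ω) (lamBondsSeq s.Ω k) W (UbgMSCoPOfRecordAtB F N ν M g K k Ω₀ s W) ∨
      UbgMSCoPOfRecordAtB F N ν M g K k Ω₀ s W = 1 := by
  by_cases hsol : W ∈ solvableDomB (avOfRecord F N K) (regMSCoPOfRecordAt F N ν K k Ω₀ s.Ω) (lamBondsSeq s.Ω k)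
  · exact Or.inl (isMinimizerB_UbgMSCoPOfRecordAtB ν M g K k Ω₀ s hsol)
  · exact Or.inr (UbgMSCoPOfRecordAtB_eq_one_of_not_mem ν M g K k Ω₀ s hsol)

/-- **THE DICHOTOMY OF THE TOTAL BACKGROUND** (record class `regMSCoPOfRecord`, print's datum `lamBondsSeq`): minimiser or `1`.
[cite: Balaban1988Convergent, (2.12)–(2.13) p.256–257; Balaban1984PropagatorsII, (2.3) p.224 (bookkeeping)] -/
theorem ubgMSCoPOfRecordB_dichotomy (ν : Stage7Numerics) (M : ℕ) (g : ℕ → ℝ) (K k : ℕ) (s : SeqOfRecord F ν M g K k)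
    (W : MSField (F.P K) (SU N)) :
    IsMinimizerB (avOfRecord F N K) (regMSCoPOfRecord F N ν K k s.Ω) (lamBondsSeq s.Ω k) W (UbgMSCoPOfRecordB F N ν M g K k s W) ∨
      UbgMSCoPOfRecordB F N ν M g K k s W = 1 := by
  by_cases hsol : W ∈ solvableDomB (avOfRecord F N K) (regMSCoPOfRecord F N ν K k s.Ω) (lamBondsSeq s.Ω k)
  · exact Or.inl (isMinimizerB_UbgMSCoPOfRecordB ν M g K k s hsol)
  · exact Or.inr (UbgMSCoPOfRecordB_eq_one_of_not_mem ν M g K k s hsol)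

/-! ## §3  The level-`0` clause «U = V₀ on Λ₀», bond form -/

/-- **`M⁰ = id` on `Λ₀`**: a minimiser under a bond-level constraint EQUALS `W₀` on every bond of the level-`0` datum (in ANY class, along ANY averaging family:
the scale-`0` average is the identity). [cite: Balaban1988Convergent, (1.12) p.248, (2.10)–(2.12) p.256; Balaban1984PropagatorsII, (2.3) p.224] -/
theorem eq_W0_of_isMinimizerB_zero {P : Params} {G : Type*} [GaugeGroup G] {av : ∀ j, Averaging P j G} {reg : Set (GaugeField P 0 G)}
    {𝔅 : BDetSet P} {W : MSField P G} {U₀ : GaugeField P 0 G} (h : IsMinimizerB av reg 𝔅 W U₀) (b : PBond P 0) (hb : b ∈ 𝔅 0) :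
    U₀ b = W 0 b := by
  simpa [avgFamily, Averaging.iter] using h.2.1 0 b hb

/-- **The `Λ₀` clause, SUPPORT READING, bond form**: solvability forces on `W₀` the scale-`0` plaquette bound `εreg·η₀²` at every plaquette OF THE SUPPORT `Ω₀`
whose four bonds lie in `Λ₀ = lamBondsSeq Ω k 0` (there a minimiser EQUALS `W₀`). [cite: Balaban1985Variational, (2),(6) p.278; Balaban1988Convergent, p.255, (1.12) p.248, (2.10)–(2.12) p.256; Balaban1984PropagatorsII, (2.3) p.224] -/
theorem dist1_W0_lt_of_mem_solvableDomB_regMSCoPAt (ν : Stage7Numerics) {K k : ℕ} (Ω₀ : Set (Site (F.P K) 0))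
    (Ω : ℕ → Set (Site (F.P K) 0)) {W : MSField (F.P K) (SU N)}
    (hW : W ∈ solvableDomB (avOfRecord F N K) (regMSCoPOfRecordAt F N ν K k Ω₀ Ω) (lamBondsSeq Ω k))
    (p : Plaq (F.P K) 0) (hp : p ∈ B8Eq17ClassAkV1.plaqsOf Ω₀)
    (h₁ : (⟨p.src, p.μ⟩ : PBond (F.P K) 0) ∈ lamBondsSeq Ω k 0) (h₂ : (⟨p.src.shift p.μ, p.ν⟩ : PBond (F.P K) 0) ∈ lamBondsSeq Ω k 0)
    (h₃ : (⟨p.src.shift p.ν, p.μ⟩ : PBond (F.P K) 0) ∈ lamBondsSeq Ω k 0) (h₄ : (⟨p.src, p.ν⟩ : PBond (F.P K) 0) ∈ lamBondsSeq Ω k 0) :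
    dist1 (GaugeField.plaqHol (W 0) p) < ν.εreg * (F.P K).eta 0 ^ 2 := by
  obtain ⟨U₀, hU₀⟩ := hW
  have hhol : GaugeField.plaqHol U₀ p = GaugeField.plaqHol (W 0) p :=
    plaqHol_eq_of_bond_eq p (eq_W0_of_isMinimizerB_zero hU₀ _ h₁) (eq_W0_of_isMinimizerB_zero hU₀ _ h₂)
      (eq_W0_of_isMinimizerB_zero hU₀ _ h₃) (eq_W0_of_isMinimizerB_zero hU₀ _ h₄)
  rw [← hhol]
  exact hU₀.1.1 0 (Nat.zero_le k) p hp

/-- Contrapositive bookkeeping: a datum whose `W₀` fails the plaquette test at a support plaquette with its four bonds in `Λ₀` is not solvable in the class on that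
support. [cite: Balaban1988Convergent, (2.10)–(2.12) p.256 (bookkeeping)] -/
theorem not_mem_solvableDomB_regMSCoPAt_of_le_plaq (ν : Stage7Numerics) {K k : ℕ} (Ω₀ : Set (Site (F.P K) 0))
    (Ω : ℕ → Set (Site (F.P K) 0)) (W : MSField (F.P K) (SU N)) (p : Plaq (F.P K) 0) (hp : p ∈ B8Eq17ClassAkV1.plaqsOf Ω₀)
    (h₁ : (⟨p.src, p.μ⟩ : PBond (F.P K) 0) ∈ lamBondsSeq Ω k 0) (h₂ : (⟨p.src.shift p.μ, p.ν⟩ : PBond (F.P K) 0) ∈ lamBondsSeq Ω k 0)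
    (h₃ : (⟨p.src.shift p.ν, p.μ⟩ : PBond (F.P K) 0) ∈ lamBondsSeq Ω k 0) (h₄ : (⟨p.src, p.ν⟩ : PBond (F.P K) 0) ∈ lamBondsSeq Ω k 0)
    (hle : ν.εreg * (F.P K).eta 0 ^ 2 ≤ dist1 (GaugeField.plaqHol (W 0) p)) :
    W ∉ solvableDomB (avOfRecord F N K) (regMSCoPOfRecordAt F N ν K k Ω₀ Ω) (lamBondsSeq Ω k) := fun hW =>
  absurd (dist1_W0_lt_of_mem_solvableDomB_regMSCoPAt ν Ω₀ Ω hW p hp h₁ h₂ h₃ h₄) (not_lt.mpr hle)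

end Literature.MathematicalPhysics.QuantumFieldTheory.Balaban1983to89.Node00

end
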